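import Literature.AnabelianGeometry.EtaleTheta.SettingModelTateSemidirect
import HarnessLib

/-!
# R78 stage 2 at the trivial exponents IS stage 1: `actχq p 0 0 = actχ p`

Mochizuki, *The étale theta function …*, Publ. RIMS **45** (2009) [EtTh], §1, PRIMS PDF p. 12
[cite: MochizukiEtTh2009, §1 p.12]. Layer L2 of the abc-iut cell (seat abc-iut-L6-d6 gen 4, R78 integration owner),
PROOF-ONLY consistency check between the two towers of the R78 cluster: abc-iut-w5-d249's stage-2 action
`actχq p i j = affTwist₃ ∘ cocyclePairHom p i j` (`SettingModelTateSemidirect.lean`) specialises at `(i, j) = (0, 0)`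
(both Kummer-cocycle exponents switched off) to abc-iut-L2-t1's stage-1 action `actχ p = twistGfp ∘ χ`
(`SettingModelChiCoverings.lean`), on `F̂₂` and on `Γ` — so `curveχq p 0 0` carries literally the stage-1 Galois action
and every stage-2 statement at `(0, 0)` is a stage-1 statement.

* `tatePairHom_zero_zero` — `cocyclePairHom p 0 0 σ = inr (χ σ)`;
* `actHatχq_zero_zero`, `actχq_zero_zero` — the actions agree (`affTwist₃_inr`: inner and shear parts vanish).

Semi-synthetic models; consistency evidence only; nothing of [EtTh] asserted; no side taken on [IUTchIII] Cor. 3.12.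
No definitions, no instances.
-/

noncomputable section

namespace Literature.AnabelianGeometry.EtaleTheta.SettingModel

open Literature.AnabelianGeometry.SemiGraphs
open Function

variable (p : ℕ) [Fact p.Prime]

/-- At `(i, j) = (0, 0)` the pair homomorphism is the section `σ ↦ inr (χ σ)`. [cite: MochizukiEtTh2009, §1 p.12] -/
theorem tatePairHom_zero_zero (σ : GQp p) :
    tatePairHom p 0 0 σ = SemidirectProduct.inr (chi p σ) := by
  refine SemidirectProduct.ext ?_ ?_
  · rw [SemidirectProduct.left_inr]
    change (kappaP p σ ^ (0 : ℤ), kappaP p σ ^ (0 : ℤ)) = 1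
    rw [zpow_zero]
    rfl
  · rfl

/-- **Stage 2 at `(0,0)` = stage 1 on `F̂₂`**: `actHatχq p 0 0 σ = θ_{χ σ} = actHatχ p σ`.
[cite: MochizukiEtTh2009, §1 p.12] -/
theorem actHatχq_zero_zero (σ : GQp p) (x : F₂hatT) : actHatχq p 0 0 σ x = actHatχ p σ x := by
  rw [actHatχq_apply, actHatχ_apply]
  change affTwist₃ (tatePairHom p 0 0 σ) x = twist (chi p σ) x
  rw [tatePairHom_zero_zero, affTwist₃_inr]

/-- **Stage 2 at `(0,0)` = stage 1 on `Γ`**: `actχq p 0 0 = actχ p`. [cite: MochizukiEtTh2009, §1 p.12] -/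
theorem actχq_zero_zero : actχq p 0 0 = actχ p := by
  refine MonoidHom.ext fun σ => MulEquiv.ext fun γ => ?_
  apply Subtype.ext
  refine Prod.ext ?_ ?_
  · change gfpFst (actχq p 0 0 σ γ) = gfpFst (actχ p σ γ)
    rw [gfpFst_actχq, actHatχq_zero_zero, actχ_apply, gfpFst_twistGfp, actHatχ_apply]
  · change gfpSnd (actχq p 0 0 σ γ) = gfpSnd (actχ p σ γ)
    rw [gfpSnd_actχq, actχ_apply, gfpSnd_twistGfp]

end Literature.AnabelianGeometry.EtaleTheta.SettingModel

end
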